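import Summits.ResolutionOfSingularities.ResolutionOfSingularities.Theorems.FrobeniusClosingSteerConeShearVec
import HarnessLib

/-!
# Cone file 3 (W4.1, idea-3 CLAIM 6; res-L0-w41-plan-1 RULING 114d): the TWO-VERTEX LEMMA — a cone over two vertices is a cone over the
# line, in coordinates (any field) and MODULO SQUARES (perfect field of characteristic `2`)

W4.1, crux `Steer` (stmt-ResolutionOfSingularities-16345); signatures CONFIRMED by res-L0-w41-idea-3 g5 12:05:30Z («TV1 ✓ TV2 ✓ TV3 ✓ (+ coordinate
form ✓) = exactly what CLAIM 6 consumes»). «Cone over `e`» = the tree word `DescentSpace.IsLineInvariant κ e Φ` (`Φ(X + t e) = Φ(X)` in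
the polynomial variable `t` — an identity, robust for finite `κ`); «cone over `e` modulo squares» = `e ∈ DescentSpace.descentSpace κ Φ`
(⟺ `∃ Q, Φ + Q²` invariant along `e`, tree L2b `DescentSpace.mem_descentSpace_iff_exists_sq`). Seat res-D-pv-007 AS res-L0-w41-stub-5.

* §1 **(TV1)** `isLineInvariant_span_pair` (any field, coordinate-free): invariant along `e₁` and `e₂` ⇒ along every `a•e₁ + b•e₂`
  (and `mem_descentSpace_span_pair`);
* §2 (adapted coordinates, char `2`, perfect) `exists_sq_eq_of_forall_even_isHomogeneous` (square roots with degree bookkeeping) and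
  `exists_sq_support_free_of_forall_single_mem`: if the coordinate vectors `e_i`, `i ∈ I`, lie in `W(Φ)`, ONE square `Q²` makes `Φ + Q²`
  free of all `X_i`, `i ∈ I` (`Q` an `n`-form when `Φ` is a `2n`-form);
* §4 **(TV2)** `exists_coords_free_two_of_isLineInvariant` (any field): for independent `e₁, e₂`, a linear change of coordinates `θ` (two
  shears; inverse `θ'`, both substituting linear forms) with `θ Φ` free of `X_{i₁}, X_{i₂}` — so `Φ = (θΦ)(θ'X)` is a polynomial in the
  `n − 2` linear forms `θ'(X_i)`, `i ∉ {i₁, i₂}`; **(TV3)** `exists_sq_isLineInvariant_pair` (char `2`, perfect): `e₁, e₂ ∈ W(Φ)` independent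
  ⇒ ONE `Q` (an `n`-form if `Φ` is a `2n`-form) with `Φ + Q²` invariant along `e₁` AND `e₂`, hence (`exists_sq_isLineInvariant_span`)
  along the whole line.
Not here (idea-3 / res-type-026 by hand or later): the Galois descent of the binary cone from `κ̄` to `κ`, CLAIM 5.

OURS (research support for an idea card; candidates, not facts); nothing here is a statement of the manuscript under review
[claim: Hironaka2017, status: under-review]; AI work, weaker than expert review. [cite: CossartPiltant2009, p. 9] [folklore]
-/

noncomputable section

-- `Summit.<S>.<S>.…` duplicates the summit name by design (single-problem summit).
set_option linter.dupNamespace false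

open MvPolynomial
open Summit.ResolutionOfSingularities.ResolutionOfSingularities.Theorems.SwitchingDichotomy.DescentSpace

namespace Summit.ResolutionOfSingularities.ResolutionOfSingularities.Theorems.SwitchingDichotomy.Cone

universe u v

/-! ## §1 Cone over two vertices is a cone over the line (coordinate-free, any field) -/

section Span

variable {κ : Type u} [Field κ] {σ : Type v}

/-- **(TV1) Two vertices ⇒ the whole line (plane of representatives)**: a polynomial invariant along `e₁` and along `e₂` is
invariant along every `a • e₁ + b • e₂`. [folklore] -/
theorem isLineInvariant_span_pair {e₁ e₂ : σ → κ} {Φ : MvPolynomial σ κ} (h₁ : IsLineInvariant κ e₁ Φ)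
    (h₂ : IsLineInvariant κ e₂ Φ) (a b : κ) : IsLineInvariant κ (a • e₁ + b • e₂) Φ :=
  (h₁.smul_dir a).add_dir (h₂.smul_dir b)

/-- The same for descent spaces (characteristic-free: `W(Φ)` is a linear subspace). [folklore] -/
theorem mem_descentSpace_span_pair [Fintype σ] {e₁ e₂ : σ → κ} {Φ : MvPolynomial σ κ}
    (h₁ : e₁ ∈ descentSpace κ Φ) (h₂ : e₂ ∈ descentSpace κ Φ) (a b : κ) : a • e₁ + b • e₂ ∈ descentSpace κ Φ :=
  descentSpace_add Φ (descentSpace_smul Φ a h₁) (descentSpace_smul Φ b h₂)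

end Span

/-! ## §2 Adapted coordinates in characteristic `2`: one common square correction -/

section AdaptedTwo

variable {κ : Type u} [Field κ] {σ : Type v} [DecidableEq σ] [CharP κ 2] [Fintype σ] [PerfectField κ]

omit [DecidableEq σ] [Fintype σ] in
/-- **Square roots of even-exponent polynomials, with degree bookkeeping** (upgrade of `DescentSpace.exists_sq_eq_of_forall_even`):
over a perfect field of characteristic `2`, a polynomial all of whose exponents are even is `Q²`, and `Q` is an `n`-form whenever
the polynomial is a `2n`-form. [folklore] -/
theorem exists_sq_eq_of_forall_even_isHomogeneous (Φ : MvPolynomial σ κ) (h : ∀ m ∈ Φ.support, ∀ j, Even (m j)) :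
    ∃ Q : MvPolynomial σ κ, Q ^ 2 = Φ ∧ ∀ n : ℕ, Φ.IsHomogeneous (2 * n) → Q.IsHomogeneous n := by
  -- halve the exponents and take square roots of the coefficients (as in `exists_sq_eq_of_forall_even`)
  have hhalf : ∀ m ∈ Φ.support, 2 • (Finsupp.mapRange (fun n => n / 2) (by simp) m) = m := by
    intro m hm
    ext j
    obtain ⟨r, hr⟩ := h m hm j
    simp only [Finsupp.smul_apply, Finsupp.mapRange_apply, smul_eq_mul]
    omega
  refine ⟨∑ m ∈ Φ.support, monomial (Finsupp.mapRange (fun n => n / 2) (by simp) m)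
      ((frobeniusEquiv κ 2).symm (coeff m Φ)), ?_, fun n hΦ => ?_⟩
  · rw [sum_pow_char 2]
    conv_rhs => rw [Φ.as_sum]
    refine Finset.sum_congr rfl fun m hm => ?_
    rw [monomial_pow, hhalf m hm]
    congr 1
    rw [← frobenius_def, ← frobeniusEquiv_apply, RingEquiv.apply_symm_apply]
  · refine IsHomogeneous.sum _ _ _ fun m hm => isHomogeneous_monomial _ ?_
    have hdeg := hΦ.degree_eq_sum_deg_support hm
    have h2 : Finsupp.degree m = 2 * Finsupp.degree (Finsupp.mapRange (fun n => n / 2) (by simp) m) := by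
      conv_lhs => rw [← hhalf m hm]
      rw [map_nsmul, smul_eq_mul]
    have h3 : Finsupp.degree m = ∑ i ∈ m.support, m i := rfl
    omega

/-- **Common square correction in adapted coordinates** (idea-3 CLAIM 6 «monomial half», in descent-space currency): if the
coordinate vectors `e_i`, `i ∈ I`, all lie in `W(Φ)` (perfect field of characteristic `2`), then ONE square `Q²` makes
`Φ + Q²` free of every `X_i`, `i ∈ I` (the part of `Φ` involving some `X_i`, `i ∈ I`, has only even exponents); `Q` is an `n`-form
whenever `Φ` is a `2n`-form. [folklore] -/
theorem exists_sq_support_free_of_forall_single_mem (Φ : MvPolynomial σ κ) (I : Finset σ)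
    (h : ∀ i ∈ I, (Pi.single i 1 : σ → κ) ∈ descentSpace κ Φ) :
    ∃ Q : MvPolynomial σ κ, (∀ n : ℕ, Φ.IsHomogeneous (2 * n) → Q.IsHomogeneous n) ∧
      ∀ m ∈ (Φ + Q ^ 2).support, ∀ i ∈ I, m i = 0 := by
  -- the part of `Φ` involving some `X_i`, `i ∈ I`
  set Φ₁ : MvPolynomial σ κ := ∑ m ∈ Φ.support.filter (fun m => ∃ i ∈ I, m i ≠ 0), monomial m (coeff m Φ) with hΦ₁
  have hcoeff : ∀ m, coeff m Φ₁ = if (∃ i ∈ I, m i ≠ 0) then coeff m Φ else 0 := fun m => by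
    rw [hΦ₁]; exact coeff_sum_filter_monomial Φ _ m
  have hsub : ∀ m ∈ Φ₁.support, m ∈ Φ.support := by
    intro m hm
    rw [mem_support_iff, hcoeff] at hm
    rw [mem_support_iff]; intro h0; exact hm (by simp [h0])
  have heven : ∀ m ∈ Φ₁.support, ∀ j, Even (m j) := by
    intro m hm j
    have hmΦ := hsub m hm
    rw [mem_support_iff, hcoeff] at hm
    have hex : ∃ i ∈ I, m i ≠ 0 := by by_contra h0; exact hm (by rw [if_neg h0])
    obtain ⟨i, hi, hmi⟩ := hex
    obtain ⟨hA, hB⟩ := (single_mem_descentSpace_iff i Φ).mp (h i hi)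
    by_cases hji : j = i
    · subst hji; exact hA m hmΦ
    · by_contra hodd
      exact hmi (hB m hmΦ j hji (Nat.not_even_iff_odd.mp hodd))
  obtain ⟨Q, hQ, hQhom⟩ := exists_sq_eq_of_forall_even_isHomogeneous Φ₁ heven
  refine ⟨Q, fun n hΦ => hQhom n ?_, fun m hm i hi => ?_⟩
  · -- `Φ₁` is a sub-sum of the `2n`-form `Φ`
    exact (isHomogeneous_iff_forall_mem_support Φ₁ (2 * n)).mpr fun m hm =>
      ((isHomogeneous_iff_forall_mem_support Φ (2 * n)).mp hΦ) m (hsub m hm)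
  · by_contra hmi
    have hex : ∃ i ∈ I, m i ≠ 0 := ⟨i, hi, hmi⟩
    rw [mem_support_iff, hQ, coeff_add, hcoeff, if_pos hex, ← two_mul] at hm
    exact hm (by rw [show (2 : κ) = 0 from CharP.cast_eq_zero κ 2 ▸ Nat.cast_two.symm, zero_mul])

end AdaptedTwo

/-! ## §4 The two-vertex lemmas -/

section TwoVertex

variable {κ : Type u} [Field κ] {σ : Type v} [DecidableEq σ]

/-- From `e₂ ∉ κ·e₁` and `e₁ i₁ ≠ 0`: the vector `v₂ = A_{e₁}⁻¹ e₂` has a non-zero coordinate off `i₁`. [folklore] -/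
theorem exists_ne_pivot_of_not_smul {e₁ e₂ : σ → κ} {i₁ : σ} (he : e₁ i₁ ≠ 0) (hind : ∀ a : κ, e₂ ≠ a • e₁) :
    ∃ i₂, i₂ ≠ i₁ ∧ (fun i => if i = i₁ then (e₁ i₁)⁻¹ * e₂ i₁ else e₂ i - e₁ i * (e₁ i₁)⁻¹ * e₂ i₁) i₂ ≠ 0 := by
  by_contra hall
  push Not at hall
  apply hind ((e₁ i₁)⁻¹ * e₂ i₁)
  funext i
  by_cases hi : i = i₁
  · subst hi; simp only [Pi.smul_apply, smul_eq_mul]; field_simp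
  · have := hall i hi
    simp only [if_neg hi] at this
    simp only [Pi.smul_apply, smul_eq_mul]
    linear_combination this

/-- **(TV2) TWO-VERTEX LEMMA, coordinates, any field** (idea-3 CLAIM 6 support; res-L0-w41-plan-1 RULING 114d): if `Φ` is a cone
over two independent vectors `e₁, e₂` (invariant along both lines), there are two indices `i₁ ≠ i₂` and a linear change of
coordinates `θ` (with inverse `θ'`, both substituting linear forms) such that `θ Φ` involves neither `X_{i₁}` nor `X_{i₂}` — so
`Φ = (θ Φ)(θ' X)` is a polynomial (a form of the same degree, if `Φ` is a form) in the `n − 2` linear forms `θ' (X i)`,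
`i ∉ {i₁, i₂}`. `θ` is the composite of two shears. [folklore] -/
theorem exists_coords_free_two_of_isLineInvariant {e₁ e₂ : σ → κ} {Φ : MvPolynomial σ κ} (he₁ : e₁ ≠ 0)
    (hind : ∀ a : κ, e₂ ≠ a • e₁) (h₁ : IsLineInvariant κ e₁ Φ) (h₂ : IsLineInvariant κ e₂ Φ) :
    ∃ (i₁ i₂ : σ) (θ θ' : MvPolynomial σ κ →ₐ[κ] MvPolynomial σ κ), i₁ ≠ i₂ ∧ (∀ P, θ' (θ P) = P) ∧
      (∀ i, (θ (X i)).IsHomogeneous 1) ∧ (∀ i, (θ' (X i)).IsHomogeneous 1) ∧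
      ∀ m ∈ (θ Φ).support, m i₁ = 0 ∧ m i₂ = 0 := by
  obtain ⟨i₁, hi₁⟩ : ∃ i, e₁ i ≠ 0 := Function.ne_iff.mp he₁
  -- first shear: `e₁ ↦ E_{i₁}`
  set v₂ : σ → κ := fun i => if i = i₁ then (e₁ i₁)⁻¹ * e₂ i₁ else e₂ i - e₁ i * (e₁ i₁)⁻¹ * e₂ i₁ with hv₂
  obtain ⟨i₂, hi₂₁, hi₂⟩ := exists_ne_pivot_of_not_smul hi₁ hind
  have hAv₂ : (fun i => if i = i₁ then e₁ i₁ * v₂ i₁ else v₂ i + e₁ i * v₂ i₁) = e₂ := shearVec_unshearVec hi₁ e₂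
  set θ₁ : MvPolynomial σ κ →ₐ[κ] MvPolynomial σ κ :=
    aeval (fun i => if i = i₁ then C (e₁ i₁) * X i₁ else X i + C (e₁ i) * X i₁) with hθ₁
  set θ₁' : MvPolynomial σ κ →ₐ[κ] MvPolynomial σ κ :=
    aeval (fun i => if i = i₁ then C (e₁ i₁)⁻¹ * X i₁ else X i - C (e₁ i * (e₁ i₁)⁻¹) * X i₁) with hθ₁'
  set θ₂ : MvPolynomial σ κ →ₐ[κ] MvPolynomial σ κ :=
    aeval (fun i => if i = i₂ then C (v₂ i₂) * X i₂ else X i + C (v₂ i) * X i₂) with hθ₂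
  set θ₂' : MvPolynomial σ κ →ₐ[κ] MvPolynomial σ κ :=
    aeval (fun i => if i = i₂ then C (v₂ i₂)⁻¹ * X i₂ else X i - C (v₂ i * (v₂ i₂)⁻¹) * X i₂) with hθ₂'
  have hE₁ : IsLineInvariant κ (Pi.single i₁ 1) (θ₁ Φ) := (isLineInvariant_iff_shear hi₁ Φ).mp h₁
  have hV₂ : IsLineInvariant κ v₂ (θ₁ Φ) := isLineInvariant_shear_of_vec (by rw [hAv₂]; exact h₂)
  have hE₂ : IsLineInvariant κ (Pi.single i₂ 1) (θ₂ (θ₁ Φ)) := (isLineInvariant_iff_shear (c := v₂) (i₀ := i₂) hi₂ _).mp hV₂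
  have hE₁' : IsLineInvariant κ (Pi.single i₁ 1) (θ₂ (θ₁ Φ)) :=
    isLineInvariant_shear_of_vec (by rw [shearVec_single_of_ne v₂ hi₂₁.symm]; exact hE₁)
  refine ⟨i₁, i₂, θ₂.comp θ₁, θ₁'.comp θ₂', hi₂₁.symm, fun P => ?_, fun i => ?_, fun i => ?_, fun m hm => ?_⟩
  · change θ₁' (θ₂' (θ₂ (θ₁ P))) = P
    rw [hθ₂', hθ₂, unshear_shear (c := v₂) (i₀ := i₂) hi₂, hθ₁', hθ₁, unshear_shear (c := e₁) (i₀ := i₁) hi₁]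
  · change (θ₂ (θ₁ (X i))).IsHomogeneous 1
    rw [hθ₁, aeval_X]
    exact isHomogeneous_aeval_of_forall _ (isHomogeneous_shearForm v₂ i₂) (isHomogeneous_shearForm e₁ i₁ i)
  · change (θ₁' (θ₂' (X i))).IsHomogeneous 1
    rw [hθ₂', aeval_X]
    exact isHomogeneous_aeval_of_forall _ (isHomogeneous_unshearForm e₁ i₁) (isHomogeneous_unshearForm v₂ i₂ i)
  · exact ⟨forall_of_isLineInvariant_single i₁ _ hE₁' m hm, forall_of_isLineInvariant_single i₂ _ hE₂ m hm⟩

variable [CharP κ 2] [Fintype σ] [PerfectField κ]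

/-- **(TV3) TWO-VERTEX LEMMA MODULO SQUARES** (idea-3 CLAIM 6's reading; perfect field of characteristic `2`): if `Φ` is a cone over
`e₁` modulo squares and over `e₂` modulo squares (`e₁, e₂ ∈ W(Φ)`, independent), then ONE square correction works for both:
`Φ + Q²` is invariant along `e₁` and along `e₂` (hence along the whole line `e₁e₂`, `isLineInvariant_span_pair`) — a binary-type
reduction by two variables. (Shear both vectors to coordinate vectors, take the common square correction
`exists_sq_support_free_of_forall_single_mem`, shear back.) `Q` is an `n`-form whenever `Φ` is a `2n`-form (idea-3 CLAIM 6 uses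
`d = 2e`). [folklore] -/
theorem exists_sq_isLineInvariant_pair {e₁ e₂ : σ → κ} {Φ : MvPolynomial σ κ} (he₁ : e₁ ≠ 0)
    (hind : ∀ a : κ, e₂ ≠ a • e₁) (h₁ : e₁ ∈ descentSpace κ Φ) (h₂ : e₂ ∈ descentSpace κ Φ) :
    ∃ Q : MvPolynomial σ κ, (∀ n : ℕ, Φ.IsHomogeneous (2 * n) → Q.IsHomogeneous n) ∧
      IsLineInvariant κ e₁ (Φ + Q ^ 2) ∧ IsLineInvariant κ e₂ (Φ + Q ^ 2) := by
  obtain ⟨i₁, hi₁⟩ : ∃ i, e₁ i ≠ 0 := Function.ne_iff.mp he₁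
  set v₂ : σ → κ := fun i => if i = i₁ then (e₁ i₁)⁻¹ * e₂ i₁ else e₂ i - e₁ i * (e₁ i₁)⁻¹ * e₂ i₁ with hv₂
  obtain ⟨i₂, hi₂₁, hi₂⟩ := exists_ne_pivot_of_not_smul hi₁ hind
  have hAv₂ : (fun i => if i = i₁ then e₁ i₁ * v₂ i₁ else v₂ i + e₁ i * v₂ i₁) = e₂ := shearVec_unshearVec hi₁ e₂
  set θ₁ : MvPolynomial σ κ →ₐ[κ] MvPolynomial σ κ :=
    aeval (fun i => if i = i₁ then C (e₁ i₁) * X i₁ else X i + C (e₁ i) * X i₁) with hθ₁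
  set θ₁' : MvPolynomial σ κ →ₐ[κ] MvPolynomial σ κ :=
    aeval (fun i => if i = i₁ then C (e₁ i₁)⁻¹ * X i₁ else X i - C (e₁ i * (e₁ i₁)⁻¹) * X i₁) with hθ₁'
  set θ₂ : MvPolynomial σ κ →ₐ[κ] MvPolynomial σ κ :=
    aeval (fun i => if i = i₂ then C (v₂ i₂) * X i₂ else X i + C (v₂ i) * X i₂) with hθ₂
  set θ₂' : MvPolynomial σ κ →ₐ[κ] MvPolynomial σ κ :=
    aeval (fun i => if i = i₂ then C (v₂ i₂)⁻¹ * X i₂ else X i - C (v₂ i * (v₂ i₂)⁻¹) * X i₂) with hθ₂'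
  -- transport the two descent-space memberships to the coordinate vectors `E_{i₁}, E_{i₂}` of `θ₂ θ₁ Φ`
  have hE₁ : (Pi.single i₁ 1 : σ → κ) ∈ descentSpace κ (θ₁ Φ) := (mem_descentSpace_iff_shear hi₁ Φ).mp h₁
  have hV₂ : v₂ ∈ descentSpace κ (θ₁ Φ) := mem_descentSpace_shear_of_vec (by rw [hAv₂]; exact h₂)
  have hE₂ : (Pi.single i₂ 1 : σ → κ) ∈ descentSpace κ (θ₂ (θ₁ Φ)) := (mem_descentSpace_iff_shear (c := v₂) (i₀ := i₂) hi₂ _).mp hV₂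
  have hE₁' : (Pi.single i₁ 1 : σ → κ) ∈ descentSpace κ (θ₂ (θ₁ Φ)) :=
    mem_descentSpace_shear_of_vec (by rw [shearVec_single_of_ne v₂ hi₂₁.symm]; exact hE₁)
  -- one common square correction upstairs
  obtain ⟨Q₂, hQ₂hom, hQ₂⟩ := exists_sq_support_free_of_forall_single_mem (θ₂ (θ₁ Φ)) {i₁, i₂}
    (fun i hi => by
      rcases Finset.mem_insert.mp hi with rfl | hi
      · exact hE₁'
      · rw [Finset.mem_singleton.mp hi]; exact hE₂)
  have hZ₁ : IsLineInvariant κ (Pi.single i₁ 1) (θ₂ (θ₁ Φ) + Q₂ ^ 2) :=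
    isLineInvariant_single_of_forall i₁ _ fun m hm => hQ₂ m hm i₁ (by simp)
  have hZ₂ : IsLineInvariant κ (Pi.single i₂ 1) (θ₂ (θ₁ Φ) + Q₂ ^ 2) :=
    isLineInvariant_single_of_forall i₂ _ fun m hm => hQ₂ m hm i₂ (by simp)
  -- shear back
  refine ⟨θ₁' (θ₂' Q₂), fun n hΦ => ?_, ?_, ?_⟩
  · have hup : (θ₂ (θ₁ Φ)).IsHomogeneous (2 * n) :=
      isHomogeneous_aeval_of_forall _ (isHomogeneous_shearForm v₂ i₂)
        (isHomogeneous_aeval_of_forall _ (isHomogeneous_shearForm e₁ i₁) hΦ)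
    exact isHomogeneous_aeval_of_forall _ (isHomogeneous_unshearForm e₁ i₁)
      (isHomogeneous_aeval_of_forall _ (isHomogeneous_unshearForm v₂ i₂) (hQ₂hom n hup))
  · have h := isLineInvariant_unshear_of_vec (c := v₂) (i₀ := i₂) hi₂ hZ₁
    rw [shearVec_single_of_ne v₂ hi₂₁.symm] at h
    have h' := isLineInvariant_unshear_of_vec (c := e₁) hi₁ h
    rw [shearVec_single_self] at h'
    rw [map_add, map_pow, map_add, map_pow, hθ₂, unshear_shear (c := v₂) (i₀ := i₂) hi₂, hθ₁, unshear_shear (c := e₁) (i₀ := i₁) hi₁] at h'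
    exact h'
  · have h := isLineInvariant_unshear_of_vec (c := v₂) (i₀ := i₂) hi₂ hZ₂
    rw [shearVec_single_self] at h
    have h' := isLineInvariant_unshear_of_vec (c := e₁) hi₁ h
    rw [hAv₂] at h'
    rw [map_add, map_pow, map_add, map_pow, hθ₂, unshear_shear (c := v₂) (i₀ := i₂) hi₂, hθ₁, unshear_shear (c := e₁) (i₀ := i₁) hi₁] at h'
    exact h'

/-- (TV3′) …hence one square correction makes `Φ` invariant along the whole line through `e₁, e₂`. [folklore] -/
theorem exists_sq_isLineInvariant_span {e₁ e₂ : σ → κ} {Φ : MvPolynomial σ κ} (he₁ : e₁ ≠ 0)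
    (hind : ∀ a : κ, e₂ ≠ a • e₁) (h₁ : e₁ ∈ descentSpace κ Φ) (h₂ : e₂ ∈ descentSpace κ Φ) :
    ∃ Q : MvPolynomial σ κ, ∀ a b : κ, IsLineInvariant κ (a • e₁ + b • e₂) (Φ + Q ^ 2) := by
  obtain ⟨Q, -, hQ₁, hQ₂⟩ := exists_sq_isLineInvariant_pair he₁ hind h₁ h₂
  exact ⟨Q, fun a b => isLineInvariant_span_pair hQ₁ hQ₂ a b⟩

end TwoVertex

end Summit.ResolutionOfSingularities.ResolutionOfSingularities.Theorems.SwitchingDichotomy.Cone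

end
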